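import Literature.NumberTheory.EllipticCurves.Wuthrich2014.ReducibleDivisibilityCyclotomicThreeMinus
import HarnessLib

/-!
# Wuthrich 2014, Thm. 16 at `p = 3`, the `ω`-COMPONENT — CLAUSE FORM, DERIVED from the tree's named
# fact `Wuthrich2014.thm16_minusEigenCharIdeal_dvd_cyclotomicThree` (NO named fact in this file)

Source: C. Wuthrich, *On the integrality of modular symbols and Kato's Euler system for elliptic
curves*, Doc. Math. 19 (2014) 381–402 [Wuthrich2014] (held copy `paper:doi-10-4171-dm-450`),
**Theorem 16** (p. 397; page file `p0013` L9): "Let `E/ℚ` be an elliptic curve and let `p > 2` be a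
prime. Suppose that `E` has semi-stable reduction at `p` and that `E[p]` is reducible as a
`G_ℚ`-module. Then `char_Λ X(E)` divides the ideal generated by `L_p(E)`. If the reduction of `E`
is split multiplicative at `p`, then `I · char_Λ X(E)` divides the ideal generated by `L_p(E)`,
where `I` is the kernel of the homomorphism `Λ → ℤ_p` that sends all elements of
[`Gal(ℚ(ζ_{p^∞})/ℚ)`] to [`1`]"; §3 (p. 390; `p0009` L19): "we split `M` up into the eigenspaces
`M = ⊕_{i=0}^{p−2} M_i` where `Δ` acts on `M_i` by the `i`-th power of the Teichmüller character";
§5 (p. 397; `p0013` L7): `X(E)` = the dual of `lim_n Sel(E/ℚ(ζ_{p^n}))`, "finitely generated …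
`Λ`-torsion … in general in our situation"; §3.2 (p. 394; `p0011` L5): `I` = the augmentation ideal;
Cor. 18 (p. 398): `L_p(E) ∈ Λ`.

HISTORY / STATUS (cell `b2b-bsdres`, KERNEL-C-P3 brick 4). The `ω`-component (`e₁`-component) of
Theorem 16 at `p = 3` — `char_{Λ(Γ)}(e₁X(E/ℚ(ζ_{3^∞}))) ∋ u · L₃(E, ω¹, T)` in the Literature
eigen-Selmer vocabulary `WeierstrassCurve.EigenSelmerDualData` (`IwasawaSelmerEigen`) — is the
tree's NAMED FACT `Wuthrich2014.thm16_minusEigenCharIdeal_dvd_cyclotomicThree`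
(`Wuthrich2014/ReducibleDivisibilityCyclotomicThreeMinus.lean`, p233088, filed by the consumer
sub-cell additive-p1). THIS module, which for a few minutes carried an independently written
duplicate transcription (p233315 by harvest-2, then p233398 by the literature seat, same path),
now holds NO named fact: it only re-packages the canonical fact in the CLAUSE FORM used by some
consumers — `ε` an arbitrary integer-valued function required to be `+1` on `Gal(ℚ̄/K)` and `−1`
off it (instead of the literal `fun g ↦ if g ∈ galRange K then 1 else −1`), and one conclusion per
local type at `3` (good ordinary / split / non-split multiplicative) instead of a disjunction over
the odd branch `Lminus`. The derivation is two lines of logic (`funext` on `ε`, then the three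
instances of the disjunction); it is a kernel CONSISTENCY CHECK between the two transcriptions and
adds no debt (D-0026: 0 new facts).

The reading (verbatim that of the canonical fact and of the product readings
`charIdeal_dvd_padicLFunction_cyclotomicThree` p206900 /
`thm16_charIdeal_dvd_[non]splitMultiplicative_cyclotomicThree` p217659, p218971; referee flag
`Wu14-Thm16-p3-branch-split`): `Λ(G) = Λ(Γ)e₀ ⊕ Λ(Γ)e₁` (`G = Gal(ℚ(ζ_{3^∞})/ℚ) = Δ × Γ`,
`Δ = {±1}`, `3 ∤ #Δ`, `ω¹ = χ_K`, `K = ℚ(ζ₃) = ℚ(√−3)`); the printed divisibility is the pair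
`char_{Λ(Γ)}(e_iX) ∣ e_iL_p(E)`; `e₁X` = the dual of the `ω`-eigenspace of `Sel_{3^∞}(E/ℚ(ζ_{3^∞}))`
under `Gal(ℚ(ζ_{3^∞})/ℚ_∞)` = any `D : EigenSelmerDualData E 3 (ker κ ⊓ galRange K) (ker κ) ε γ`
(`κ : ZpExtension ℚ 3` cyclotomic, `γ ∈ Gal(ℚ̄/K)` a topological generator with `χ₃(γ)·ζ = 4`, hence
`ζ = 1` and `T = γ_* − 1` is the tree's variable `1 + T ↔ 4`); `e₁L_p(E) = L₃(E,ω¹,T)` on the minus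
modular symbols (MTT §I.13), `= u·ϖ'·padicLFunctionMinusBranch f (unitRoot E 3) 1` (good ordinary)
resp. `u·ϖ'·padicLFunctionMinusBranchMult f (±1) 1` (split / non-split), `ϖ'·|Ω⁻(E)| = Ω⁻_f`,
`u ∈ ℤ₃ˣ`; `e₁I = e₁Λ`, so no extra factor on this component in the split case.

HONEST FRAMING (cell `b2b-bsdres`): a published theorem read componentwise; the cell's class labels
are unchanged by this file; nothing here is "finishing BSD".
-/

set_option autoImplicit false

noncomputable section

open scoped Classical MatrixGroups ModularForm

open CongruenceSubgroup WeierstrassCurve Literature.NumberTheory.EllipticCurves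
  Literature.NumberTheory.EllipticCurves.ModularForms
  Literature.NumberTheory.GaloisRepresentations

namespace Literature.NumberTheory.EllipticCurves.Wuthrich2014

/-- **Wuthrich 2014, Theorem 16 at `p = 3`, `E[3]` reducible, `ω`-component — clause form, DERIVED
from the named fact `thm16_minusEigenCharIdeal_dvd_cyclotomicThree`.** As printed (Doc. Math. 19
(2014), Thm. 16, p. 397): "Let `E/ℚ` be an elliptic curve and let `p > 2` be a prime. Suppose that
`E` has semi-stable reduction at `p` and that `E[p]` is reducible as a `G_ℚ`-module. Then
`char_Λ X(E)` divides the ideal generated by `L_p(E)`. If the reduction of `E` is split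
multiplicative at `p`, then `I · char_Λ X(E)` divides the ideal generated by `L_p(E)` […]"; read on
the `ω`-eigencomponent at `p = 3` (§3 p. 390 "`M = ⊕ M_i`"): for `V` globally minimal with `V[3]`
reducible, `K = ℚ(ζ₃)` (`galRange K` normal), `κ` cyclotomic with topological generator
`γ ∈ galRange K` matching the cyclotomic variable, `ε = χ_K` as a sign (here: ANY `ε` that is `1` on
`galRange K` and `−1` off it — it is then the literal character of the canonical fact, `funext`),
`f` the newform of `V`, `D` any dual datum of the `ω`-eigen-Selmer group, `ϖ'·|Ω⁻(V)| = Ω⁻_f`: in each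
local type at `3` — good ordinary (`α = unitRoot V 3`, two-term measure), split (`α = 1`), non-split
multiplicative (`α = −1`; one-term measure, MTT §I.10) — `D.X` is `Λ`-torsion and
`ι g = C(u ϖ')·L⁻₃(f, α, ω¹, T)` for some `g ∈ char_Λ D.X`, `u ∈ ℤ₃ˣ`. Proof: specialise the canonical
fact's disjunction over `Lminus` to each branch. No new assertion (0 debt); flag family
`Wu14-Thm16-p3-branch-split`.
[cite: Wuthrich2014, Thm. 16 and §5 (p. 397), §3 (p. 390), §3.2 (p. 394), Cor. 18 (p. 398)]
[cite: MazurTateTeitelbaum1986Invent, §I.10, §I.13] -/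
theorem charIdeal_minusComponent_dvd_padicLFunction_cyclotomicThree_of_thm16
    (h : thm16_minusEigenCharIdeal_dvd_cyclotomicThree) :
    ∀ (V : WeierstrassCurve ℚ) [V.IsElliptic] [V.IsGloballyMinimal]
      (K : Type) [Field K] [NumberField K] [IsCyclotomicExtension {3} ℚ K]
      [(galRange (K := ℚ) K).Normal]
      {κ : ZpExtension ℚ 3} {γ : Field.absoluteGaloisGroup ℚ} {ε : Field.absoluteGaloisGroup ℚ → ℤ}
      {N : ℕ} [NeZero N] {f : CuspForm (Gamma0 N) 2},
      ¬ V.HasIrreducibleModPGaloisRep 3 →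
      κ.IsCyclotomic → κ.IsTopGenerator γ → IsCyclotomicVariable 3 γ → γ ∈ galRange (K := ℚ) K →
      (∀ g, g ∈ galRange (K := ℚ) K → ε g = 1) → (∀ g, g ∉ galRange (K := ℚ) K → ε g = -1) →
      IsNewformOf V f →
      ∀ (D : V.EigenSelmerDualData 3 (κ.kerSubgroup ⊓ galRange (K := ℚ) K) κ.kerSubgroup ε γ)
        (ϖ' : ℚ), (ϖ' : ℝ) * V.imaginaryPeriodRat = minusPeriod f →
        -- good ordinary `3`: two-term measure, `α = unitRoot V 3`
        (IsOrdinaryAt V 3 →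
          Module.IsTorsion (IwasawaAlgebra 3) D.X ∧
          ∃ g ∈ D.charIdeal, ∃ u : ℤ_[3]ˣ,
            iwasawaToPowerSeries 3 g =
              PowerSeries.C (((u : ℤ_[3]) : ℚ_[3]) * (ϖ' : ℚ_[3])) *
                padicLFunctionMinusBranch f ((unitRoot V 3 : ℤ_[3]) : ℚ_[3]) 1) ∧
        -- split multiplicative `3`: one-term measure, `α = a₃ = 1`; no `I`-factor on `e₁`
        (V.HasSplitMultiplicativeReductionAtPrime 3 →
          Module.IsTorsion (IwasawaAlgebra 3) D.X ∧
          ∃ g ∈ D.charIdeal, ∃ u : ℤ_[3]ˣ,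
            iwasawaToPowerSeries 3 g =
              PowerSeries.C (((u : ℤ_[3]) : ℚ_[3]) * (ϖ' : ℚ_[3])) *
                padicLFunctionMinusBranchMult f (1 : ℚ_[3]) 1) ∧
        -- non-split multiplicative `3`: one-term measure, `α = a₃ = −1`
        (V.HasMultiplicativeReductionAtPrime 3 → ¬ V.HasSplitMultiplicativeReductionAtPrime 3 →
          Module.IsTorsion (IwasawaAlgebra 3) D.X ∧
          ∃ g ∈ D.charIdeal, ∃ u : ℤ_[3]ˣ,
            iwasawaToPowerSeries 3 g =
              PowerSeries.C (((u : ℤ_[3]) : ℚ_[3]) * (ϖ' : ℚ_[3])) *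
                padicLFunctionMinusBranchMult f (-1 : ℚ_[3]) 1) := by
  intro V _ _ K _ _ _ _ κ γ ε N _ f hred hκ hγ hcyc hγK hε₁ hε₂ hf D ϖ' hϖ'
  obtain rfl : ε = fun g ↦ if g ∈ galRange (K := ℚ) K then 1 else -1 := by
    funext g
    split_ifs with hg
    exacts [hε₁ g hg, hε₂ g hg]
  exact ⟨fun hord ↦ h V K _ (Or.inl ⟨hord, rfl⟩) hred hκ hγ hcyc hγK hf D ϖ' hϖ',
    fun hsplit ↦ h V K _ (Or.inr (Or.inl ⟨hsplit, rfl⟩)) hred hκ hγ hcyc hγK hf D ϖ' hϖ',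
    fun hmult hns ↦ h V K _ (Or.inr (Or.inr ⟨hmult, hns, rfl⟩)) hred hκ hγ hcyc hγK hf D ϖ' hϖ'⟩

end Literature.NumberTheory.EllipticCurves.Wuthrich2014

end
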